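import Summits.Ventures.HSemireg.GeneralStructureWiring
import Summits.Ventures.HSemireg.GeneralStructureWiringBloch
import Summits.Ventures.HSemireg.GeneralStructureWiringPrimitiveMiddle
import Summits.HodgeConjecture.HodgeConjecture.Theorems.Ring2HypothesesGermDomination
import HarnessLib

/-!
# HSemireg venture · general structure — LEDGER (L2): the G4 wiring with `HC_CM` DISCHARGED by André 1992 and ring 2's anchor leaves

HONEST FRAMING (speculative tier of cell `pub-hsemireg`, team «general structure»; seat `deform-ring2` =
ring 2's route seat `deform`, re-pointed; page 1, verbatim the cell's wording rule): **nothing here says `HC_AV`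
or `HC_CM` is proved; every implication carries its NAMED hypotheses.** Ring-2 framing, verbatim: research route
conditional on HC_CM; not a corollary; Q11.4-sentence-2 already refuted in dim ≥ 3. This file is a Lean INDEX of
implication chains; it asserts NOTHING about any explicit variety, contains no `sorry`, no new `def`, no new axiom,
no new Literature fact, and uses only `propext`, `Classical.choice`, `Quot.sound`.

## What this sibling file adds to seat G4's wiring (`GeneralStructureWiring*.lean`, gs-g4) — and ONLY this

Seat G4's rows read, for each form `Lift` of the team's uniform-semiregularity hypothesis,

  (L1)  `HC_CM ∧ [Deligne 1982 Prop. 6.1] ∧ [transfer fact] ∧ Lift ⟹ HC_AV`,   `HC_CM` load-bearing, consumed once.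

Ring 2 proves (file `Ring2HypothesesGermDomination.lean`, rows G3/G4 there) that on ANY line whose transport leaf is
the CM-germ leaf `Ring2.Hypotheses.LocalVHCAtCM`, the binder `HC_CM` is DOMINATED modulo three `HC_CM`-free inputs:
André 1992 (refereed NAMED FACT `Andre1992_hodgeClasses_cmAbelianVariety_mem_span_pullback_weilClasses`: every Hodge
class on a CM abelian variety is a combination of pull-backs of Weil classes) and ring 2's two DIVISOR-GENERATED
CM-POINTED ANCHOR LEAVES `Ring2Transport.DivisorGeneratedCMPointedWeilFamiliesQuadratic` (P₂; in print for every
imaginary quadratic field — Murasaki/Imai/Tate + Landherr + Mumford 1969 §3 — OPEN as a formal statement of the tree)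
and `Ring2Transport.DivisorGeneratedCMPointedWeilFamiliesCMField` (P₃; in print for ANCHOR-GOOD CM fields only —
Gordon Thm. 6.4 / Hazama, Dodson; OPEN in Lean and, for non-anchor-good fields, not even expected from the moduli
argument — ring 2's transport-seat CAVEAT, carried verbatim). Composing with each of seat G4's leaf rows gives

  (L2)  `[André 1992] ∧ P₂ ∧ P₃ ∧ [Deligne 1982 Prop. 6.1] ∧ [transfer fact] ∧ Lift ⟹ HC_CM ∧ HC_AV`,   `HC_CM` occurring ZERO times.

Both ledgers are displayed so that the GS report can list them side by side with print status; NEITHER is a proof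
sketch of `HC_CM` or `HC_AV` (the uniform lift is OURS, SPECULATIVE, labelled «plausibly false as a ∀-statement»;
P₂/P₃ are open leaves). The rows below are one-line compositions of tree theorems BY NAME (count-once rule: no
ring-2 or G4 arrow is re-proved here).

## Rows (kernel-checked)

| row | theorem | `Lift` (gs-g4's def) | transfer fact(s) | conclusion |
|---|---|---|---|---|
| L2-S-cm | `hc_cm_of_andre_of_anchors_of_buchweitzFlenner_of_uniformSheafLift` | `UniformSemiregularSheafLiftAtCM C` | BF 2003 Thm. 5.1 | `HC_CM` |
| L2-S | `hc_av_of_andre_of_anchors_of_cmAnchoredFamilies_of_buchweitzFlenner_of_uniformSheafLift` | same | BF 5.1; anchors `CMAnchoredFamilies` | `HC_AV` |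
| L2-S′ | `hc_av_of_andre_of_anchors_of_deligne1982_of_buchweitzFlenner_of_uniformSheafLift` | same | BF 5.1; Deligne 1982 Prop. 6.1 (fact) | `HC_AV` |
| L2-B-cm / L2-B′ | `…_of_blochSpread_of_catanese_of_uniformBlochLift` | `UniformBlochLiftAtCM` | Bloch (7.4)/BF 5.2 (`BlochSemiregularSpread`), Catanese 2002 | `HC_CM` / `HC_AV` |
| L2-PM-cm / L2-PM′ | `…_of_catanese_of_buchweitzFlenner_of_uniformSheafLiftPrimitiveMiddle` | `UniformSemiregularSheafLiftAtCMPrimitiveMiddle C` (thinned) | BF 5.1, Catanese 2002 | `HC_CM` / `HC_AV` |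
| L2-PMB-cm / L2-PMB′ | `…_of_catanese_of_blochSpread_of_uniformBlochLiftPrimitiveMiddle` | `UniformBlochLiftAtCMPrimitiveMiddle` (thinned) | Bloch (7.4), Catanese 2002 | `HC_CM` / `HC_AV` |
| L2-pos | `ledgerL2_position` | — | — | conjunction: each HC_CM-free bundle ⟹ `HC_CM ∧ HC_AV` |

NOT COVERED (recorded, not hidden): seat G4's per-component ∃-form `ExistsSemiregularSheafCMAnchor C`
(`GeneralStructureWiringAnchor.lean`) moves the anchor from Deligne's CM fibre `s₀` to a team-chosen CM fibre `s₁`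
and does NOT factor through `LocalVHCAtCM`; ring 2 has no domination theorem for that pivot, so its ledger stays (L1)
(`HC_CM` load-bearing — it is the ONLY source of algebraicity at `s₁`).

VACUITY LEDGER (red team, T5-style; numbers, not adjectives). (i) On-path: the summit `HodgeConjecture` gives every
CONCLUSION here (`Ring2.Deform.HC_CM_of_hodgeConjecture`, `Ring2.Deform.HC_AV_of_hodgeConjecture`), so no row can be
vacuous-by-false-conclusion unless HC itself fails. (ii) Hypotheses: André 1992, Deligne 1982 Prop. 6.1,
Buchweitz–Flenner 2003 Thm. 5.1, Bloch 1972 (7.4) (as `BlochSemiregularSpread`), Catanese 2002 Thm. 4.1 are refereed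
theorems typed as named facts; P₂, P₃ are OPEN Summit-side leaves with NO on-path lemma (they assert families;
their Weil-class consequences have on-path lemmas `WeilTypeLadder.weilClassesImaginaryQuadratic_of_hodgeConjecture`,
`…weilClassesCMField_of_hodgeConjecture`); the four `Lift` forms are gs-g4's `@[conjecture]` defs with no on-path
lemma. Hence `False` follows from an L2 bundle only if it follows from print ∧ P₂ ∧ P₃ ∧ Lift. (iii) `HC_CM`
occurrences in the hypotheses of this file: 0. New `def`s: 0. Theorems: 13. Sorries: 0.

## References (bib keys)

Andre1992HodgeCM (Théorème), Gordon1997 (Thm. 6.4, §3 Theorem, Prop. 9.4.1), Deligne1982HodgeCycles (Prop. 6.1; §4),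
BuchweitzFlenner2003 (§5 Thm. 5.1, Thm. 5.2), Bloch1972Semiregularity (Thm. (7.4)), Catanese2002DeformationTypes
(§4 Thm. 4.1, 4.6), CharlesSchnell2014Notes (Prop. 11.3.11, Thm. 11.3.17, Thm. 11.5.11), vanGeemen1994HodgeAV (5.2–5.8),
Landherr1936HermitianForms (Hauptsatz), Mumford1969NoteShimura (§3).
-/

noncomputable section

open CategoryTheory
open Literature.AlgebraicGeometry Literature.AlgebraicGeometry.Motives
open Literature.AlgebraicGeometry.HodgeTheory
open Literature.AlgebraicGeometry.Deligne1982 (deligne1982_cmDenseMumfordTateFamilies)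

namespace Summit.Ventures.HSemireg.GeneralStructure

open Summit.HodgeConjecture.HodgeConjecture
open Summit.HodgeConjecture.HodgeConjecture.Ring2.Hypotheses (CMAnchoredFamilies LocalVHCAtCM
  HC_CM_of_andre_of_divisorGeneratedCMPointed_of_localVHCAtCM
  HC_AV_of_andre_of_divisorGeneratedCMPointed_of_cmAnchoredFamilies_of_localVHCAtCM)
open Summit.HodgeConjecture.HodgeConjecture.Ring2.Binders (localVHCAtCM_of_primitiveMiddleFrom_four_of_catanese2002)
open Summit.HodgeConjecture.HodgeConjecture.Ring2Transport (DivisorGeneratedCMPointedWeilFamiliesQuadratic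
  DivisorGeneratedCMPointedWeilFamiliesCMField)

/-! ### §1 Sheaf ∀-form (`UniformSemiregularSheafLiftAtCM C`, gs-g4 row G4-1) with `HC_CM` discharged -/

/-- **L2-S-cm — `HC_CM` FROM the uniform sheaf lift, granted André 1992, the two divisor-generated CM-pointed anchor
leaves and Buchweitz–Flenner Thm. 5.1.** Composition of ring 2's G3
(`Ring2.Hypotheses.HC_CM_of_andre_of_divisorGeneratedCMPointed_of_localVHCAtCM`) with gs-g4's G4-1
(`localVHCAtCM_of_buchweitzFlenner_of_uniformSheafLift`). NOT a proof sketch of `HC_CM`: the lift is speculative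
(«plausibly false as a ∀-statement»), P₂/P₃ are open leaves (P₃ printed for anchor-good CM fields only).
[cite: Andre1992HodgeCM, Théorème] [cite: Gordon1997, Thm. 6.4 and Prop. 9.4.1] [cite: BuchweitzFlenner2003, §5 Thm. 5.1] -/
theorem hc_cm_of_andre_of_anchors_of_buchweitzFlenner_of_uniformSheafLift (C : ChernCharacterBetti)
    (hA : Andre1992_hodgeClasses_cmAbelianVariety_mem_span_pullback_weilClasses)
    (hP₂ : DivisorGeneratedCMPointedWeilFamiliesQuadratic) (hP₃ : DivisorGeneratedCMPointedWeilFamiliesCMField)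
    (hBF : BuchweitzFlenner2003_variationalHodge_ISemiregular) (hL : UniformSemiregularSheafLiftAtCM C) :
    Theses.RankFourFaces.CMAbelianHodge :=
  HC_CM_of_andre_of_divisorGeneratedCMPointed_of_localVHCAtCM hA hP₂ hP₃
    (localVHCAtCM_of_buchweitzFlenner_of_uniformSheafLift C hBF hL)

/-- **L2-S — `HC_AV` on the sheaf row with `HC_CM` DISCHARGED**: André ∧ P₂ ∧ P₃ ∧ `CMAnchoredFamilies` ∧ BF 5.1 ∧
uniform sheaf lift ⟹ `HC_AV` (ring 2's G4 `HC_AV_of_andre_of_divisorGeneratedCMPointed_of_cmAnchoredFamilies_of_localVHCAtCM`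
∘ gs-g4's G4-1). `HC_CM` occurs zero times. [cite: Andre1992HodgeCM, Théorème] [cite: Deligne1982HodgeCycles, Prop. 6.1]
[cite: BuchweitzFlenner2003, §5 Thm. 5.1] [cite: CharlesSchnell2014Notes, Thm. 11.3.17] -/
theorem hc_av_of_andre_of_anchors_of_cmAnchoredFamilies_of_buchweitzFlenner_of_uniformSheafLift (C : ChernCharacterBetti)
    (hA : Andre1992_hodgeClasses_cmAbelianVariety_mem_span_pullback_weilClasses)
    (hP₂ : DivisorGeneratedCMPointedWeilFamiliesQuadratic) (hP₃ : DivisorGeneratedCMPointedWeilFamiliesCMField)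
    (hMT : CMAnchoredFamilies) (hBF : BuchweitzFlenner2003_variationalHodge_ISemiregular)
    (hL : UniformSemiregularSheafLiftAtCM C) : Theses.PadicSemiregularLift.HodgeAbelianVarieties :=
  HC_AV_of_andre_of_divisorGeneratedCMPointed_of_cmAnchoredFamilies_of_localVHCAtCM hA hP₂ hP₃ hMT
    (localVHCAtCM_of_buchweitzFlenner_of_uniformSheafLift C hBF hL)

/-- **L2-S′ — the same with the anchors supplied by PRINT** (Deligne 1982 Prop. 6.1, dense form, through ring 2's
`Ring2.Deform.cmAnchoredFamilies_of_deligne1982`): André ∧ P₂ ∧ P₃ ∧ [Deligne 1982] ∧ [BF 5.1] ∧ uniform sheaf lift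
⟹ `HC_AV`. Every hypothesis but P₂, P₃ and the lift is a refereed fact. [cite: Andre1992HodgeCM, Théorème]
[cite: Deligne1982HodgeCycles, Prop. 6.1] [cite: CharlesSchnell2014Notes, Thm. 11.5.11] [cite: BuchweitzFlenner2003, §5 Thm. 5.1] -/
theorem hc_av_of_andre_of_anchors_of_deligne1982_of_buchweitzFlenner_of_uniformSheafLift (C : ChernCharacterBetti)
    (hA : Andre1992_hodgeClasses_cmAbelianVariety_mem_span_pullback_weilClasses)
    (hP₂ : DivisorGeneratedCMPointedWeilFamiliesQuadratic) (hP₃ : DivisorGeneratedCMPointedWeilFamiliesCMField)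
    (hD : deligne1982_cmDenseMumfordTateFamilies) (hBF : BuchweitzFlenner2003_variationalHodge_ISemiregular)
    (hL : UniformSemiregularSheafLiftAtCM C) : Theses.PadicSemiregularLift.HodgeAbelianVarieties :=
  hc_av_of_andre_of_anchors_of_cmAnchoredFamilies_of_buchweitzFlenner_of_uniformSheafLift C hA hP₂ hP₃
    (Ring2.Deform.cmAnchoredFamilies_of_deligne1982 hD) hBF hL

/-! ### §2 Cycle (lci) form (`UniformBlochLiftAtCM`, gs-g4 row B-1) with `HC_CM` discharged -/

/-- **L2-B-cm — `HC_CM` FROM the uniform Bloch lift**, granted André, P₂, P₃, Bloch (7.4)/BF 5.2 (`BlochSemiregularSpread`,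
refereed fact) and Catanese 2002 (refereed fact): ring 2's G3 ∘ gs-g4's B-1 `localVHCAtCM_of_blochSpread_of_catanese_of_uniformBlochLift`.
[cite: Andre1992HodgeCM, Théorème] [cite: Bloch1972Semiregularity, Thm. (7.4)] [cite: Catanese2002DeformationTypes, §4 Thm. 4.1] -/
theorem hc_cm_of_andre_of_anchors_of_blochSpread_of_catanese_of_uniformBlochLift
    (hA : Andre1992_hodgeClasses_cmAbelianVariety_mem_span_pullback_weilClasses)
    (hP₂ : DivisorGeneratedCMPointedWeilFamiliesQuadratic) (hP₃ : DivisorGeneratedCMPointedWeilFamiliesCMField)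
    (hB : ∀ m p : ℕ, BlochSemiregularSpread m p) (hC : catanese2002_abelianFibres_of_abelianFibre)
    (hL : UniformBlochLiftAtCM) : Theses.RankFourFaces.CMAbelianHodge :=
  HC_CM_of_andre_of_divisorGeneratedCMPointed_of_localVHCAtCM hA hP₂ hP₃
    (localVHCAtCM_of_blochSpread_of_catanese_of_uniformBlochLift hB hC hL)

/-- **L2-B′ — `HC_AV` on the cycle row with `HC_CM` DISCHARGED, anchors by print**: André ∧ P₂ ∧ P₃ ∧ [Deligne 1982]
∧ [Bloch (7.4)] ∧ [Catanese 2002] ∧ uniform Bloch lift ⟹ `HC_AV`. [cite: Andre1992HodgeCM, Théorème]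
[cite: Deligne1982HodgeCycles, Prop. 6.1] [cite: Bloch1972Semiregularity, Thm. (7.4)] [cite: Catanese2002DeformationTypes, §4 Thm. 4.1] -/
theorem hc_av_of_andre_of_anchors_of_deligne1982_of_blochSpread_of_catanese_of_uniformBlochLift
    (hA : Andre1992_hodgeClasses_cmAbelianVariety_mem_span_pullback_weilClasses)
    (hP₂ : DivisorGeneratedCMPointedWeilFamiliesQuadratic) (hP₃ : DivisorGeneratedCMPointedWeilFamiliesCMField)
    (hD : deligne1982_cmDenseMumfordTateFamilies) (hB : ∀ m p : ℕ, BlochSemiregularSpread m p)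
    (hC : catanese2002_abelianFibres_of_abelianFibre) (hL : UniformBlochLiftAtCM) :
    Theses.PadicSemiregularLift.HodgeAbelianVarieties :=
  HC_AV_of_andre_of_divisorGeneratedCMPointed_of_cmAnchoredFamilies_of_localVHCAtCM hA hP₂ hP₃
    (Ring2.Deform.cmAnchoredFamilies_of_deligne1982 hD)
    (localVHCAtCM_of_blochSpread_of_catanese_of_uniformBlochLift hB hC hL)

/-! ### §3 THINNED forms (primitive middle classes, relative dimension ≥ 4; gs-g4 rows PM-1 / PM-1c) with `HC_CM`
discharged — the forms the engines' Weil tables instantiate literally; ring 2's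
`Ring2.Binders.localVHCAtCM_of_primitiveMiddleFrom_four_of_catanese2002` (hard Lefschetz + Kerr–Pearlstein, mod
Catanese 2002) un-thins the leaf. -/

/-- **L2-PM-cm — `HC_CM` FROM the THINNED uniform sheaf lift** (primitive middle classes only), granted André, P₂, P₃,
Catanese 2002 and BF 5.1. [cite: Andre1992HodgeCM, Théorème] [cite: Catanese2002DeformationTypes, §4 Thm. 4.1 and Thm. 4.6]
[cite: BuchweitzFlenner2003, §5 Thm. 5.1] [cite: KerrPearlstein2011, §3.1] -/
theorem hc_cm_of_andre_of_anchors_of_catanese_of_buchweitzFlenner_of_uniformSheafLiftPrimitiveMiddle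
    (C : ChernCharacterBetti)
    (hA : Andre1992_hodgeClasses_cmAbelianVariety_mem_span_pullback_weilClasses)
    (hP₂ : DivisorGeneratedCMPointedWeilFamiliesQuadratic) (hP₃ : DivisorGeneratedCMPointedWeilFamiliesCMField)
    (hC : catanese2002_abelianFibres_of_abelianFibre) (hBF : BuchweitzFlenner2003_variationalHodge_ISemiregular)
    (hL : UniformSemiregularSheafLiftAtCMPrimitiveMiddle C) : Theses.RankFourFaces.CMAbelianHodge :=
  HC_CM_of_andre_of_divisorGeneratedCMPointed_of_localVHCAtCM hA hP₂ hP₃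
    (localVHCAtCM_of_primitiveMiddleFrom_four_of_catanese2002 hC
      (localVHCAtCMPrimitiveMiddleFrom_four_of_buchweitzFlenner_of_uniformSheafLiftPrimitiveMiddle C hBF hL))

/-- **L2-PM′ — `HC_AV` on the thinned sheaf row with `HC_CM` DISCHARGED, anchors by print.**
[cite: Andre1992HodgeCM, Théorème] [cite: Deligne1982HodgeCycles, Prop. 6.1] [cite: Catanese2002DeformationTypes, §4 Thm. 4.1 and Thm. 4.6]
[cite: BuchweitzFlenner2003, §5 Thm. 5.1] -/
theorem hc_av_of_andre_of_anchors_of_deligne1982_of_catanese_of_buchweitzFlenner_of_uniformSheafLiftPrimitiveMiddle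
    (C : ChernCharacterBetti)
    (hA : Andre1992_hodgeClasses_cmAbelianVariety_mem_span_pullback_weilClasses)
    (hP₂ : DivisorGeneratedCMPointedWeilFamiliesQuadratic) (hP₃ : DivisorGeneratedCMPointedWeilFamiliesCMField)
    (hD : deligne1982_cmDenseMumfordTateFamilies) (hC : catanese2002_abelianFibres_of_abelianFibre)
    (hBF : BuchweitzFlenner2003_variationalHodge_ISemiregular) (hL : UniformSemiregularSheafLiftAtCMPrimitiveMiddle C) :
    Theses.PadicSemiregularLift.HodgeAbelianVarieties :=
  HC_AV_of_andre_of_divisorGeneratedCMPointed_of_cmAnchoredFamilies_of_localVHCAtCM hA hP₂ hP₃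
    (Ring2.Deform.cmAnchoredFamilies_of_deligne1982 hD)
    (localVHCAtCM_of_primitiveMiddleFrom_four_of_catanese2002 hC
      (localVHCAtCMPrimitiveMiddleFrom_four_of_buchweitzFlenner_of_uniformSheafLiftPrimitiveMiddle C hBF hL))

/-- **L2-PMB-cm — `HC_CM` FROM the THINNED uniform Bloch lift**, granted André, P₂, P₃, Bloch (7.4), Catanese 2002.
[cite: Andre1992HodgeCM, Théorème] [cite: Bloch1972Semiregularity, Thm. (7.4)] [cite: Catanese2002DeformationTypes, §4 Thm. 4.1 and Thm. 4.6] -/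
theorem hc_cm_of_andre_of_anchors_of_catanese_of_blochSpread_of_uniformBlochLiftPrimitiveMiddle
    (hA : Andre1992_hodgeClasses_cmAbelianVariety_mem_span_pullback_weilClasses)
    (hP₂ : DivisorGeneratedCMPointedWeilFamiliesQuadratic) (hP₃ : DivisorGeneratedCMPointedWeilFamiliesCMField)
    (hC : catanese2002_abelianFibres_of_abelianFibre) (hB : ∀ m p : ℕ, BlochSemiregularSpread m p)
    (hL : UniformBlochLiftAtCMPrimitiveMiddle) : Theses.RankFourFaces.CMAbelianHodge :=
  HC_CM_of_andre_of_divisorGeneratedCMPointed_of_localVHCAtCM hA hP₂ hP₃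
    (localVHCAtCM_of_primitiveMiddleFrom_four_of_catanese2002 hC
      (localVHCAtCMPrimitiveMiddleFrom_four_of_blochSpread_of_catanese_of_uniformBlochLiftPrimitiveMiddle hB hC hL))

/-- **L2-PMB′ — `HC_AV` on the thinned cycle row with `HC_CM` DISCHARGED, anchors by print.**
[cite: Andre1992HodgeCM, Théorème] [cite: Deligne1982HodgeCycles, Prop. 6.1] [cite: Bloch1972Semiregularity, Thm. (7.4)]
[cite: Catanese2002DeformationTypes, §4 Thm. 4.1 and Thm. 4.6] -/
theorem hc_av_of_andre_of_anchors_of_deligne1982_of_catanese_of_blochSpread_of_uniformBlochLiftPrimitiveMiddle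
    (hA : Andre1992_hodgeClasses_cmAbelianVariety_mem_span_pullback_weilClasses)
    (hP₂ : DivisorGeneratedCMPointedWeilFamiliesQuadratic) (hP₃ : DivisorGeneratedCMPointedWeilFamiliesCMField)
    (hD : deligne1982_cmDenseMumfordTateFamilies) (hC : catanese2002_abelianFibres_of_abelianFibre)
    (hB : ∀ m p : ℕ, BlochSemiregularSpread m p) (hL : UniformBlochLiftAtCMPrimitiveMiddle) :
    Theses.PadicSemiregularLift.HodgeAbelianVarieties :=
  HC_AV_of_andre_of_divisorGeneratedCMPointed_of_cmAnchoredFamilies_of_localVHCAtCM hA hP₂ hP₃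
    (Ring2.Deform.cmAnchoredFamilies_of_deligne1982 hD)
    (localVHCAtCM_of_primitiveMiddleFrom_four_of_catanese2002 hC
      (localVHCAtCMPrimitiveMiddleFrom_four_of_blochSpread_of_catanese_of_uniformBlochLiftPrimitiveMiddle hB hC hL))

/-! ### §4 Position: on every `LocalVHCAtCM` row the `HC_CM`-FREE bundle already yields `HC_CM ∧ HC_AV` -/

/-- **L2-pos — POSITION (kernel-checked conjunction; no new content).** Granted André 1992 and the anchor leaves P₂, P₃,
each of gs-g4's four `LocalVHCAtCM`-valued lift forms, together with its printed transfer fact(s) and Deligne 1982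
Prop. 6.1, yields `HC_CM ∧ HC_AV` with `HC_CM` occurring zero times among the hypotheses: on these rows `HC_CM` is
DOMINATED (ledger L2), while on gs-g4's own rows (ledger L1) it is load-bearing. The GS report lists both; print
status: André, Deligne, BF 5.1, Bloch (7.4), Catanese — refereed; P₂ — in print (every imaginary quadratic field is
anchor-good), unformalised; P₃ — in print for anchor-good CM fields only; the lifts — ours, speculative.
[cite: Andre1992HodgeCM, Théorème] [cite: Gordon1997, Thm. 6.4 and Prop. 9.4.1] [cite: Deligne1982HodgeCycles, Prop. 6.1]
[cite: BuchweitzFlenner2003, §5 Thm. 5.1] [cite: Bloch1972Semiregularity, Thm. (7.4)] -/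
theorem ledgerL2_position (C : ChernCharacterBetti)
    (hA : Andre1992_hodgeClasses_cmAbelianVariety_mem_span_pullback_weilClasses)
    (hP₂ : DivisorGeneratedCMPointedWeilFamiliesQuadratic) (hP₃ : DivisorGeneratedCMPointedWeilFamiliesCMField)
    (hD : deligne1982_cmDenseMumfordTateFamilies) :
    (BuchweitzFlenner2003_variationalHodge_ISemiregular → UniformSemiregularSheafLiftAtCM C →
      Theses.RankFourFaces.CMAbelianHodge ∧ Theses.PadicSemiregularLift.HodgeAbelianVarieties) ∧
    ((∀ m p : ℕ, BlochSemiregularSpread m p) → catanese2002_abelianFibres_of_abelianFibre → UniformBlochLiftAtCM →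
      Theses.RankFourFaces.CMAbelianHodge ∧ Theses.PadicSemiregularLift.HodgeAbelianVarieties) ∧
    (catanese2002_abelianFibres_of_abelianFibre → BuchweitzFlenner2003_variationalHodge_ISemiregular →
      UniformSemiregularSheafLiftAtCMPrimitiveMiddle C →
      Theses.RankFourFaces.CMAbelianHodge ∧ Theses.PadicSemiregularLift.HodgeAbelianVarieties) ∧
    (catanese2002_abelianFibres_of_abelianFibre → (∀ m p : ℕ, BlochSemiregularSpread m p) →
      UniformBlochLiftAtCMPrimitiveMiddle →
      Theses.RankFourFaces.CMAbelianHodge ∧ Theses.PadicSemiregularLift.HodgeAbelianVarieties) :=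
  ⟨fun hBF hL ↦ ⟨hc_cm_of_andre_of_anchors_of_buchweitzFlenner_of_uniformSheafLift C hA hP₂ hP₃ hBF hL,
      hc_av_of_andre_of_anchors_of_deligne1982_of_buchweitzFlenner_of_uniformSheafLift C hA hP₂ hP₃ hD hBF hL⟩,
    fun hB hC hL ↦ ⟨hc_cm_of_andre_of_anchors_of_blochSpread_of_catanese_of_uniformBlochLift hA hP₂ hP₃ hB hC hL,
      hc_av_of_andre_of_anchors_of_deligne1982_of_blochSpread_of_catanese_of_uniformBlochLift hA hP₂ hP₃ hD hB hC hL⟩,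
    fun hC hBF hL ↦
      ⟨hc_cm_of_andre_of_anchors_of_catanese_of_buchweitzFlenner_of_uniformSheafLiftPrimitiveMiddle C hA hP₂ hP₃ hC hBF hL,
        hc_av_of_andre_of_anchors_of_deligne1982_of_catanese_of_buchweitzFlenner_of_uniformSheafLiftPrimitiveMiddle
          C hA hP₂ hP₃ hD hC hBF hL⟩,
    fun hC hB hL ↦
      ⟨hc_cm_of_andre_of_anchors_of_catanese_of_blochSpread_of_uniformBlochLiftPrimitiveMiddle hA hP₂ hP₃ hC hB hL,
        hc_av_of_andre_of_anchors_of_deligne1982_of_catanese_of_blochSpread_of_uniformBlochLiftPrimitiveMiddle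
          hA hP₂ hP₃ hD hC hB hL⟩⟩

/-- **ON-PATH (the trivial direction, so nothing here is summit-progress rhetoric):** the summit alone gives both
conclusions of every row. [cite: CharlesSchnell2014Notes, Cor. 11.3.6] -/
theorem ledgerL2_conclusions_of_hodgeConjecture (h : _root_.HodgeConjecture) :
    Theses.RankFourFaces.CMAbelianHodge ∧ Theses.PadicSemiregularLift.HodgeAbelianVarieties :=
  ⟨Ring2.Deform.HC_CM_of_hodgeConjecture h, Ring2.Deform.HC_AV_of_hodgeConjecture h⟩

/-! ## Audit: nothing is decided here

Every theorem above whose conclusion is `HC_CM` or `HC_AV` has among its hypotheses one of the team's OPEN,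
SPECULATIVE lift statements AND ring 2's two OPEN anchor leaves P₂, P₃, together with refereed named facts; or it is
the on-path lemma from `HodgeConjecture`. Axiom closures: the three standard axioms only. -/

#print axioms Summit.Ventures.HSemireg.GeneralStructure.hc_cm_of_andre_of_anchors_of_buchweitzFlenner_of_uniformSheafLift
#print axioms Summit.Ventures.HSemireg.GeneralStructure.hc_av_of_andre_of_anchors_of_deligne1982_of_buchweitzFlenner_of_uniformSheafLift
#print axioms Summit.Ventures.HSemireg.GeneralStructure.hc_av_of_andre_of_anchors_of_deligne1982_of_blochSpread_of_catanese_of_uniformBlochLift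
#print axioms Summit.Ventures.HSemireg.GeneralStructure.hc_av_of_andre_of_anchors_of_deligne1982_of_catanese_of_buchweitzFlenner_of_uniformSheafLiftPrimitiveMiddle
#print axioms Summit.Ventures.HSemireg.GeneralStructure.ledgerL2_position

end Summit.Ventures.HSemireg.GeneralStructure

end
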